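import Summits.ABC.StewartYu.PadicG3ParNBudgetB
import HarnessLib

/-!
# The `𝔑`-threaded odd-`p` record `PadicG3ParN` — budget atoms, file Ac: the U-branch conditioning allowance
# `AcondV s ν` at EVERY level `s ≤ ŜN` (floor phase included) against `CondFloorN`

Support file (theorems only; no named facts). Cell `abc-stewartyu`, route `YuMatveevShapeRat`, crux r3 `PadicCoreOddRat`
(stmt-ABC-20503); seat p1 (record owner), for p2's `ineqPackSat_schedN_one` (hypotheses `hKlam/hHlam` quantify `lev ≤ ŜN`).
The landed `PadicG3ParVE.AcondV_nodes_le/_tlog_le/AcondV_le` require `s ≤ ŜG`; here the SAME proofs run with the depth `ŜN`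
(`2^s ≤ 2^{ŜN}` lands in `CondFloorN ν = 2^{ν+1}·2^{ŜN}·g·XV·(log p/(p−1))`, and `ŜN ≤ LgV/4 + LgV/504 − 2` replaces `4(ŜG+2) ≤ LgV`):
* `AcondV_nodes_le_N`, `AcondV_tlog_le_N`, **`AcondV_le_N`** — `AcondV s ν ≤ 2^ν·(52/100)·Zp + (22/100)·Zp + 2 + CondFloorN ν`
  for `ν ≤ n`, `s ≤ ŜN`, `½ ≤ θ₀`, `N_q = K`, `gⁿ ≤ K` (every `m`).

## References
* [Nesterenko2003] Yu. V. Nesterenko, LNM 1819 (2003) — §4.2 (4.30)–(4.31).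
-/

noncomputable section

open Finset Real

namespace Summit.ABC.StewartYu

namespace PadicG3ParN

variable {n : ℕ} (P : PadicG3ParN n)

/-- (a) the nodes term up to the TRUE depth: `(2^{ν+1}XsV s + 1)(TV s + 1)·(log p/(p−1)) ≤ 2^ν·(52/100)·Zp + Zp/256 + 2 + CondFloorN ν`
for `s ≤ ŜN`. [folklore] -/
theorem AcondV_nodes_le_N {s : ℕ} (hs : s ≤ P.SdN) (ν : ℕ) :
    (2 ^ (ν + 1) * (P.XsV s : ℝ) + 1) * (P.TV s + 1) * (Real.log P.p / (P.p - 1)) ≤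
      2 ^ ν * ((52 / 100) * P.Zp) + P.Zp / 256 + 2 + P.CondFloorN ν := by
  obtain ⟨hκ1, hκ0⟩ := P.kappa_le_one
  set κ := Real.log P.p / (P.p - 1) with hκ
  have hXs := P.XsV_mul_le s
  have hT := P.TV_add_one_le s
  obtain ⟨hGt, _, hLt, hGL, hXL⟩ := P.tinyV
  have hZ := P.Zp_facts.1
  have hG16 := P.sixteen_le_G
  have hg : 0 ≤ P.g := by linarith [P.one_le_g]
  have hX : (0 : ℝ) ≤ P.XV := by positivity
  have hL : (0 : ℝ) ≤ P.LgV := by positivity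
  have h2ν : (0 : ℝ) < 2 ^ ν := by positivity
  have h2s1 : (1 : ℝ) ≤ 2 ^ s := one_le_pow₀ (by norm_num)
  have h2sS : (2 : ℝ) ^ s ≤ 2 ^ P.SdN := pow_le_pow_right₀ (by norm_num) hs
  -- `g XV LgV = Zp/G ≤ Zp/16`
  have hgXL : P.g * P.XV * P.LgV ≤ P.Zp / 16 := by
    unfold PadicG3Par.Zp; rw [le_div_iff₀ (by norm_num)]
    have h0 : 0 ≤ P.g * P.XV * P.LgV := by positivity
    nlinarith
  have hT8 : (P.TV s : ℝ) + 1 ≤ 8 * P.LgV + 2 := by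
    have : 8 * (P.LgV : ℝ) / 2 ^ s ≤ 8 * P.LgV := by
      rw [div_le_iff₀ (by positivity)]; nlinarith
    linarith
  -- expand
  have e : (2 ^ (ν + 1) * (P.XsV s : ℝ) + 1) * (P.TV s + 1) =
      2 * 2 ^ ν * ((P.XsV s : ℝ) * (P.TV s + 1)) + (P.TV s + 1) := by rw [pow_succ]; ring
  have hmain : (2 ^ (ν + 1) * (P.XsV s : ℝ) + 1) * (P.TV s + 1) ≤
      2 ^ ν * (8 * P.g * P.XV * P.LgV + 16 * P.LgV + 4) + 2 ^ (ν + 1) * 2 ^ P.SdN * P.g * P.XV +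
        (8 * P.LgV + 2) := by
    rw [e]
    have h1 : 2 * 2 ^ ν * ((P.XsV s : ℝ) * (P.TV s + 1)) ≤
        2 * 2 ^ ν * (4 * P.g * P.XV * P.LgV + 2 ^ s * P.g * P.XV + 8 * P.LgV + 2) :=
      mul_le_mul_of_nonneg_left hXs (by positivity)
    have h2 : (2 : ℝ) ^ s * P.g * P.XV ≤ 2 ^ P.SdN * P.g * P.XV := by gcongr
    have h3 : 2 * 2 ^ ν * ((2 : ℝ) ^ s * P.g * P.XV) ≤ 2 ^ (ν + 1) * 2 ^ P.SdN * P.g * P.XV := by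
      rw [pow_succ]; nlinarith [mul_nonneg h2ν.le (sub_nonneg.mpr h2)]
    nlinarith
  -- multiply by `κ ≤ 1` (all terms nonnegative), keeping `κ` on the floor term
  have hA0 : 0 ≤ 2 ^ ν * (8 * P.g * P.XV * P.LgV + 16 * P.LgV + 4) + (8 * (P.LgV : ℝ) + 2) := by positivity
  have hF0 : 0 ≤ (2 : ℝ) ^ (ν + 1) * 2 ^ P.SdN * P.g * P.XV := by positivity
  have hN0 : 0 ≤ (2 ^ (ν + 1) * (P.XsV s : ℝ) + 1) * (P.TV s + 1) := by positivity
  have step : (2 ^ (ν + 1) * (P.XsV s : ℝ) + 1) * (P.TV s + 1) * κ ≤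
      (2 ^ ν * (8 * P.g * P.XV * P.LgV + 16 * P.LgV + 4) + (8 * P.LgV + 2)) * 1 +
        2 ^ (ν + 1) * 2 ^ P.SdN * P.g * P.XV * κ := by
    have := mul_le_mul_of_nonneg_right hmain hκ0
    have h2 : (2 ^ ν * (8 * P.g * P.XV * P.LgV + 16 * P.LgV + 4) + (8 * (P.LgV : ℝ) + 2)) * κ ≤
        (2 ^ ν * (8 * P.g * P.XV * P.LgV + 16 * P.LgV + 4) + (8 * P.LgV + 2)) * 1 :=
      mul_le_mul_of_nonneg_left hκ1 hA0
    nlinarith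
  have hCF : 2 ^ (ν + 1) * 2 ^ P.SdN * P.g * P.XV * κ = P.CondFloorN ν := by unfold CondFloorN; rw [hκ]
  rw [hCF] at step
  -- bound the `Zp`-part
  have hB : 2 ^ ν * (8 * P.g * P.XV * P.LgV + 16 * P.LgV + 4) ≤ 2 ^ ν * ((52 / 100) * P.Zp) := by
    apply mul_le_mul_of_nonneg_left _ h2ν.le
    have hZ36 := P.Zp_ge
    nlinarith
  have hC : 8 * (P.LgV : ℝ) + 2 ≤ P.Zp / 256 + 2 := by linarith
  linarith


set_option maxHeartbeats 400000 in
/-- (c) the `t · log 2N` term up to the TRUE depth: `(TV s + 1)·log(2(2^{ν+1}XsV s + 1)) ≤ (15/100)·Zp` for `ν ≤ n`, `s ≤ ŜN`.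
[folklore] -/
theorem AcondV_tlog_le_N (hNq : P.Nq = P.K) (hgK : P.g ^ n ≤ (P.K : ℝ)) {s ν : ℕ} (hs : s ≤ P.SdN) (hν : ν ≤ n) :
    ((P.TV s : ℝ) + 1) * Real.log (2 * (2 ^ (ν + 1) * (P.XsV s : ℝ) + 1)) ≤ (15 / 100) * P.Zp := by
  have hlog := P.AcondV_log_le s ν
  have hT := P.TV_add_one_le s
  obtain ⟨hGt, _, hLt, hGL, hXL⟩ := P.tinyV
  have hZ := P.Zp_facts.1
  have hG16 := P.sixteen_le_G
  have hn := P.n_le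
  have hνn : (ν : ℝ) ≤ n := by exact_mod_cast hν
  have hsS : (s : ℝ) ≤ P.SdN := by exact_mod_cast hs
  have hS4 : (P.SdN : ℝ) ≤ P.LgV / 4 + P.LgV / 504 - 2 := P.SdN_real_le hNq hgK
  have hl2 : Real.log 2 ≤ 7 / 10 := by have := Real.log_two_lt_d9; linarith
  have hl20 : 0 ≤ Real.log 2 := Real.log_nonneg (by norm_num)
  have hX0 : (0 : ℝ) ≤ P.XV := by positivity
  have hL0 : (0 : ℝ) ≤ P.LgV := by positivity
  have hG0 : (0 : ℝ) ≤ P.G := by linarith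
  have h2s : (0 : ℝ) < 2 ^ s := by positivity
  -- `s/2^s ≤ 1/2`
  have hs2 : (s : ℝ) / 2 ^ s ≤ 1 / 2 := by
    rw [div_le_iff₀ h2s]
    have : ((2 * s : ℕ) : ℝ) ≤ ((2 ^ s : ℕ) : ℝ) := by exact_mod_cast Literature.NumberTheory.EllipticCurves.two_mul_le_two_pow s
    push_cast at this; linarith
  have hlog0 : 0 ≤ Real.log (2 * (2 ^ (ν + 1) * (P.XsV s : ℝ) + 1)) := by
    apply Real.log_nonneg
    have : (1 : ℝ) ≤ P.XsV s := by exact_mod_cast P.one_le_XsV s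
    have : (1 : ℝ) ≤ 2 ^ (ν + 1) := one_le_pow₀ (by norm_num)
    nlinarith
  have hT0 : (0 : ℝ) ≤ P.TV s + 1 := by positivity
  -- `(TV+1) · log 2N ≤ (8LgV/2^s + 2) · ((ν+s+3) log 2 + G/16 + XV/4)`
  have h1 : ((P.TV s : ℝ) + 1) * Real.log (2 * (2 ^ (ν + 1) * (P.XsV s : ℝ) + 1)) ≤
      (8 * P.LgV / 2 ^ s + 2) * (((ν : ℝ) + s + 3) * Real.log 2 + P.G / 16 + P.XV / 4) :=
    mul_le_mul hT hlog hlog0 (by positivity)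
  -- split: `(8LgV/2^s)·s·log 2 ≤ 8 LgV · (1/2) · (7/10)`
  have hA : 8 * (P.LgV : ℝ) / 2 ^ s * ((s : ℝ) * Real.log 2) ≤ 8 * P.LgV * (1 / 2) * (7 / 10) := by
    have e : 8 * (P.LgV : ℝ) / 2 ^ s * ((s : ℝ) * Real.log 2) = 8 * P.LgV * ((s : ℝ) / 2 ^ s) * Real.log 2 := by
      field_simp
    rw [e]
    have h0 : 0 ≤ 8 * (P.LgV : ℝ) := by positivity
    have h5 : 8 * (P.LgV : ℝ) * ((s : ℝ) / 2 ^ s) ≤ 8 * P.LgV * (1 / 2) := mul_le_mul_of_nonneg_left hs2 h0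
    have hs0 : 0 ≤ 8 * (P.LgV : ℝ) * ((s : ℝ) / 2 ^ s) := by positivity
    calc 8 * (P.LgV : ℝ) * ((s : ℝ) / 2 ^ s) * Real.log 2 ≤ 8 * P.LgV * ((s : ℝ) / 2 ^ s) * (7 / 10) :=
          mul_le_mul_of_nonneg_left hl2 hs0
      _ ≤ 8 * P.LgV * (1 / 2) * (7 / 10) := mul_le_mul_of_nonneg_right h5 (by norm_num)
  have hB : 8 * (P.LgV : ℝ) / 2 ^ s ≤ 8 * P.LgV := by
    rw [div_le_iff₀ h2s]; have : (1 : ℝ) ≤ 2 ^ s := one_le_pow₀ (by norm_num); nlinarith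
  -- assemble: everything in `Zp` units
  have hrest0 : 0 ≤ ((ν : ℝ) + 3) * Real.log 2 + P.G / 16 + P.XV / 4 := by positivity
  have h2 : (8 * P.LgV / 2 ^ s + 2) * (((ν : ℝ) + s + 3) * Real.log 2 + P.G / 16 + P.XV / 4) =
      8 * P.LgV / 2 ^ s * ((s : ℝ) * Real.log 2) +
        8 * P.LgV / 2 ^ s * (((ν : ℝ) + 3) * Real.log 2 + P.G / 16 + P.XV / 4) +
        2 * (((ν : ℝ) + s + 3) * Real.log 2 + P.G / 16 + P.XV / 4) := by ring
  have h3 : 8 * (P.LgV : ℝ) / 2 ^ s * (((ν : ℝ) + 3) * Real.log 2 + P.G / 16 + P.XV / 4) ≤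
      8 * P.LgV * (((n : ℝ) + 3) * (7 / 10) + P.G / 16 + P.XV / 4) := by
    have : ((ν : ℝ) + 3) * Real.log 2 + P.G / 16 + P.XV / 4 ≤ ((n : ℝ) + 3) * (7 / 10) + P.G / 16 + P.XV / 4 := by
      nlinarith
    calc 8 * (P.LgV : ℝ) / 2 ^ s * (((ν : ℝ) + 3) * Real.log 2 + P.G / 16 + P.XV / 4)
        ≤ 8 * P.LgV * (((ν : ℝ) + 3) * Real.log 2 + P.G / 16 + P.XV / 4) := mul_le_mul_of_nonneg_right hB hrest0
      _ ≤ 8 * P.LgV * (((n : ℝ) + 3) * (7 / 10) + P.G / 16 + P.XV / 4) :=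
          mul_le_mul_of_nonneg_left this (by positivity)
  have h4 : 2 * (((ν : ℝ) + s + 3) * Real.log 2 + P.G / 16 + P.XV / 4) ≤
      2 * (((n : ℝ) + P.SdN + 3) * (7 / 10) + P.G / 16 + P.XV / 4) := by nlinarith
  -- numeric pieces in `Zp` units
  have hL25 : (2 : ℝ) ^ 25 ≤ P.LgV := by
    have h1 : 2 ^ 25 ≤ 2 ^ (n + 25) := Nat.pow_le_pow_right (by norm_num) (by omega)
    exact_mod_cast h1.trans P.two_pow_le_LgV
  have hXV : (P.XV : ℝ) ≤ P.Zp / 2 ^ 29 := by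
    have h16 : (P.XV : ℝ) * P.LgV * 16 ≤ P.Zp := (le_div_iff₀ (by norm_num)).mp hXL
    have h25 : (P.XV : ℝ) * 2 ^ 25 ≤ P.XV * P.LgV := mul_le_mul_of_nonneg_left hL25 hX0
    have h25' := mul_le_mul_of_nonneg_right h25 (by norm_num : (0:ℝ) ≤ 16)
    rw [le_div_iff₀ (by positivity)]
    have e29 : (P.XV : ℝ) * 2 ^ 29 = (P.XV : ℝ) * 2 ^ 25 * 16 := by ring
    rw [e29]
    exact h25'.trans h16
  have hT1 : 8 * (P.LgV : ℝ) * (1 / 2) * (7 / 10) ≤ P.Zp / 512 := by linarith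
  have hT2 : 8 * (P.LgV : ℝ) * (((n : ℝ) + 3) * (7 / 10) + P.G / 16 + P.XV / 4) ≤ (14 / 100) * P.Zp := by
    have e : 8 * (P.LgV : ℝ) * (((n : ℝ) + 3) * (7 / 10) + P.G / 16 + P.XV / 4) =
        (56 / 10) * (((n : ℝ) + 3) * P.LgV) + (P.G * P.LgV) / 2 + 2 * (P.XV * P.LgV) := by ring
    have hn3 : ((n : ℝ) + 3) * P.LgV ≤ P.G * P.LgV / 8 + 2 * P.LgV := by
      have := mul_le_mul_of_nonneg_right (show (n : ℝ) + 3 ≤ P.G / 8 + 2 by linarith) hL0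
      linarith
    rw [e]; linarith
  have hT3 : 2 * (((n : ℝ) + P.SdN + 3) * (7 / 10) + P.G / 16 + P.XV / 4) ≤ P.Zp / 1000 + 5 := by
    have hSd : (P.SdN : ℝ) ≤ P.LgV / 3 := by linarith
    linarith
  have htot : (8 * P.LgV / 2 ^ s + 2) * (((ν : ℝ) + s + 3) * Real.log 2 + P.G / 16 + P.XV / 4) ≤
      P.Zp / 512 + (14 / 100) * P.Zp + (P.Zp / 1000 + 5) :=
    calc (8 * P.LgV / 2 ^ s + 2) * (((ν : ℝ) + s + 3) * Real.log 2 + P.G / 16 + P.XV / 4)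
        = 8 * P.LgV / 2 ^ s * ((s : ℝ) * Real.log 2) +
            8 * P.LgV / 2 ^ s * (((ν : ℝ) + 3) * Real.log 2 + P.G / 16 + P.XV / 4) +
            2 * (((ν : ℝ) + s + 3) * Real.log 2 + P.G / 16 + P.XV / 4) := h2
      _ ≤ 8 * P.LgV * (1 / 2) * (7 / 10) + 8 * P.LgV * (((n : ℝ) + 3) * (7 / 10) + P.G / 16 + P.XV / 4) +
            2 * (((n : ℝ) + P.SdN + 3) * (7 / 10) + P.G / 16 + P.XV / 4) := add_le_add (add_le_add hA h3) h4
      _ ≤ P.Zp / 512 + (14 / 100) * P.Zp + (P.Zp / 1000 + 5) := add_le_add (add_le_add hT1 hT2) hT3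
  have hZ36 := P.Zp_ge
  have hfin : P.Zp / 512 + (14 / 100) * P.Zp + (P.Zp / 1000 + 5) ≤ (15 / 100) * P.Zp := by
    have h36 : (2 : ℝ) ^ 36 = 68719476736 := by norm_num
    rw [h36] at hZ36
    linarith only [hZ36]
  exact h1.trans (htot.trans hfin)


/-- **`AcondV s ν ≤ 2^ν·(52/100)·Zp + (22/100)·Zp + 2 + CondFloorN ν`** for `ν ≤ n`, `s ≤ ŜN`, under `½ ≤ θ₀`, `N_q = K`,
`gⁿ ≤ K` (`4 LgV log p ≤ 8 G LgV ≤ Zp/16`; every `m`). [cite: Nesterenko2003, §4.2 (4.30)] -/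
theorem AcondV_le_N (hθ : 1 / 2 ≤ P.θ₀) (hNq : P.Nq = P.K) (hgK : P.g ^ n ≤ (P.K : ℝ)) {s ν : ℕ}
    (hs : s ≤ P.SdN) (hν : ν ≤ n) :
    P.AcondV s ν ≤ 2 ^ ν * ((52 / 100) * P.Zp) + (22 / 100) * P.Zp + 2 + P.CondFloorN ν := by
  have ha := P.AcondV_nodes_le_N hs ν
  have hc := P.AcondV_tlog_le_N hNq hgK hs hν
  obtain ⟨_, _, _, hGL, _⟩ := P.tinyV
  have hlogp : Real.log P.p ≤ 2 * P.G := by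
    have := P.θ₀_log_le_G; have := P.log_p_pos; nlinarith
  have hL0 : (0 : ℝ) ≤ P.LgV := by positivity
  have hd : 4 * (P.LgV : ℝ) * Real.log P.p ≤ P.Zp / 16 := by nlinarith
  unfold PadicG3Par.AcondV
  linarith

/-- `CondFloorN` is monotone in the stage (all `ν ≤ ν'`). [folklore] -/
theorem CondFloorN_mono' {ν ν' : ℕ} (h : ν ≤ ν') : P.CondFloorN ν ≤ P.CondFloorN ν' := by
  unfold CondFloorN
  obtain ⟨_, hκ0⟩ := P.kappa_le_one
  have hg : 0 ≤ P.g := by linarith [P.one_le_g]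
  have h0 : 0 ≤ (2 : ℝ) ^ P.SdN * P.g * P.XV * (Real.log P.p / (P.p - 1)) := by positivity
  have h1 : (2 : ℝ) ^ (ν + 1) ≤ 2 ^ (ν' + 1) := pow_le_pow_right₀ (by norm_num) (by omega)
  calc (2 : ℝ) ^ (ν + 1) * 2 ^ P.SdN * P.g * P.XV * (Real.log P.p / (P.p - 1))
      = 2 ^ (ν + 1) * (2 ^ P.SdN * P.g * P.XV * (Real.log P.p / (P.p - 1))) := by ring
    _ ≤ 2 ^ (ν' + 1) * (2 ^ P.SdN * P.g * P.XV * (Real.log P.p / (P.p - 1))) := mul_le_mul_of_nonneg_right h1 h0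
    _ = _ := by ring

end PadicG3ParN

end Summit.ABC.StewartYu
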